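import Mathlib

/-!
# Critic g46 certificate: the card k1-g43's extra binder `hθlt` is dischargeable from the frame's `hθc` alone.

`θ : K →+* L` a CONTINUOUS ring hom between normed fields (division rings suffice): `‖x‖ < 1 ⟹ ‖θ x‖ < 1`
(`x^n → 0`, continuity at `0`, `‖y^n‖ → 0 ⟺ ‖y‖ < 1`).  So `WeakSeamK1G43`'s
`(hθlt : ∀ x : CompletedAlgClosure F, ‖x‖ < 1 → ‖θ x‖ < 1)` follows from `(hθc : Continuous θ)` of the frame
of record (`θ : CompletedAlgClosure F →+* ℂ_[2]`), i.e. P1 of the card is a two-line support lemma, not a hypothesis.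
-/

theorem norm_map_lt_one_of_continuous {K L : Type*} [NormedDivisionRing K] [NormedDivisionRing L]
    (θ : K →+* L) (hθc : Continuous θ) {x : K} (hx : ‖x‖ < 1) : ‖θ x‖ < 1 := by
  have h1 : Filter.Tendsto (fun n : ℕ => x ^ n) Filter.atTop (nhds 0) :=
    tendsto_pow_atTop_nhds_zero_of_norm_lt_one hx
  have h2 : Filter.Tendsto (fun n : ℕ => θ x ^ n) Filter.atTop (nhds 0) := by
    have h := ((hθc.tendsto 0).comp h1)
    simp only [map_zero] at h
    refine h.congr ?_
    intro n
    simp [map_pow]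
  exact tendsto_pow_atTop_nhds_zero_iff_norm_lt_one.mp h2

/-- The `hθlt`-shaped corollary, verbatim the binder of `WeakSeamK1G43.delta_read₂`. -/
theorem hθlt_of_continuous {K L : Type*} [NormedField K] [NormedField L]
    (θ : K →+* L) (hθc : Continuous θ) : ∀ x : K, ‖x‖ < 1 → ‖θ x‖ < 1 :=
  fun _ hx => norm_map_lt_one_of_continuous θ hθc hx
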